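import Mathlib
import HarnessLib
import Literature.Combinatorics.SimpleGraph.LasserreStableBound
import Literature.Combinatorics.SimpleGraph.LasserreCliqueCover
import Summits.PneNP.PneNP.Theses.RamseyUncertifiable
import Summits.PneNP.PneNP.Theorems.RamseyUncertifiableSosUncertaintyReductions

/-!
# Route `RamseyUncertifiable`, item `SosUncertainty` (stmt-PneNP-9815) — tightness of the statement

Definition-free records of what the quantifier shape of `UP_t` (`SosUncertainty`) can and cannot
afford, after the crux disprover's standing file (refuter-cdisprove-stmt-PneNP-9815,
`Cruxes/SosUncertainty/Disproof.lean` §§(a)–(d), whose proofs are adapted here so that they live in an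
importable Theorems module):

* `not_sosUncertainty_without_level_pos` — the hypothesis `1 ≤ t` is load-bearing: at `t = 0` both
  factors are the junk value `0` (tree: `lasserreStableBound_zero`);
* `uncertaintyProduct_bot_le_card` (with the tree's `lasserreStableBound_top_le_one`), `not_sosUncertainty_superlinear` — the edgeless graph has
  `f_t(⊥) ≤ n` at every level, so NO level admits an exponent `δ > 1` (Lovász's level-1 exponent is
  optimal throughout the hierarchy);
* `level_two_uncertaintyProduct_cycleGraph_five_le`, `not_levelTwo_lovaszShape` — on the pentagon
  `las₂ · las₂ ≤ 4 < 5`: the Lovász shape (`δ = 1`, `n₀ = 1`) already fails at level `2`, so the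
  `∃ δ, ∃ n₀` slack is genuinely used (with `uncertaintyProduct_sum_eq`, `m · C₅` gives `4n/5` for
  every `n₀`);
* `uncertaintyProduct_le_indepNum_mul_lovaszTheta`, `delta_le_of_boundedAlpha_family` — the only
  refutation surface at level `t`: graphs with `α ≤ t` (one factor exact by finite convergence, the
  other `≤ ϑ`); a family with `α ≤ t` and `ϑ(Gᶜ) ≤ C n^γ` caps every admissible `δ` at level `t` by
  `γ` (Alon's triangle-free family: `δ₂ ≤ 2/3`), but by Erdős–Szekeres such families have
  `γ ≥ 1/t` (`RamseyUncertifiableSosUncertaintyRegime.lean`) and never refute the item.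
[folklore; credit: refuter-cdisprove-stmt-PneNP-9815 Disproof (a)–(d)]
-/

-- the Theorems namespace `Summit.PneNP.PneNP.Theorems` is prescribed by the tree layout
set_option linter.dupNamespace false

namespace Summit.PneNP.PneNP.Theorems.SosUncertainty

open Literature.Combinatorics.SimpleGraph Finset
open Summit.PneNP.PneNP.Theses.RamseyUncertifiable (SosUncertainty)

/-! ### (a) The level hypothesis is load-bearing -/

/-- **`1 ≤ t` cannot be dropped**: with `t = 0` allowed the statement is false (both factors are the
junk value `las_0 = 0`; witness `t = 0`, `n = n₀ + 1`, `G = ⊥`). [credit: Disproof (a)] -/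
theorem not_sosUncertainty_without_level_pos :
    ¬ ∀ t : ℕ, ∃ δ : ℝ, 0 < δ ∧ ∃ n₀ : ℕ, ∀ n ≥ n₀, ∀ G : SimpleGraph (Fin n),
      (n : ℝ) ^ δ ≤ lasserreStableBound G t * lasserreStableBound Gᶜ t := by
  intro h
  obtain ⟨δ, _hδ, n₀, hn⟩ := h 0
  have h1 := hn (n₀ + 1) (by omega) ⊥
  rw [lasserreStableBound_zero, zero_mul] at h1
  have h2 : (0 : ℝ) < ((n₀ + 1 : ℕ) : ℝ) ^ δ := Real.rpow_pos_of_pos (by positivity) δ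
  linarith

/-! ### (b) No exponent above `1` -/

section Tightness

variable {V : Type} [Fintype V] [DecidableEq V]

/-- **The edgeless graph**: `las_t(⊥) · las_t(⊥ᶜ) ≤ n` at every level `t ≥ 1`.
[credit: Disproof (b)] -/
theorem uncertaintyProduct_bot_le_card {t : ℕ} (ht : 1 ≤ t) :
    lasserreStableBound (⊥ : SimpleGraph V) t * lasserreStableBound (⊥ : SimpleGraph V)ᶜ t ≤
      Fintype.card V := by
  rw [compl_bot]
  calc lasserreStableBound (⊥ : SimpleGraph V) t * lasserreStableBound (⊤ : SimpleGraph V) t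
      ≤ (Fintype.card V : ℝ) * 1 :=
        mul_le_mul (lasserreStableBound_le_card ⊥ t ht) (lasserreStableBound_top_le_one ht)
          (lasserreStableBound_nonneg ⊤ t ht) (Nat.cast_nonneg _)
    _ = Fintype.card V := mul_one _

end Tightness

/-- **No level admits an exponent `δ > 1`**: Lovász's level-1 exponent is optimal throughout the
hierarchy (witness `G = ⊥` on `Fin (max n₀ 2)`). (Registered sub-goal of stmt-PneNP-9815 for this
file.) [credit: Disproof (b)] -/
theorem not_sosUncertainty_superlinear :
    ¬ ∃ t : ℕ, 1 ≤ t ∧ ∃ δ : ℝ, 1 < δ ∧ ∃ n₀ : ℕ, ∀ n ≥ n₀, ∀ G : SimpleGraph (Fin n),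
      (n : ℝ) ^ δ ≤ lasserreStableBound G t * lasserreStableBound Gᶜ t := by
  rintro ⟨t, ht, δ, hδ, n₀, hn⟩
  have h1 := hn (max n₀ 2) (le_max_left _ _) ⊥
  have h2 := uncertaintyProduct_bot_le_card (V := Fin (max n₀ 2)) ht
  rw [Fintype.card_fin] at h2
  have hgt : (1 : ℝ) < ((max n₀ 2 : ℕ) : ℝ) := by
    have : (2 : ℕ) ≤ max n₀ 2 := le_max_right _ _
    exact_mod_cast this
  have h3 : ((max n₀ 2 : ℕ) : ℝ) ^ (1 : ℝ) < ((max n₀ 2 : ℕ) : ℝ) ^ δ :=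
    Real.rpow_lt_rpow_of_exponent_lt hgt hδ
  rw [Real.rpow_one] at h3
  linarith

/-! ### (c) The Lovász shape fails at level `2`: the pentagon -/

section Pentagon

/-- Every `3`-subset of the pentagon `cycleGraph 5` spans an edge … -/
theorem cycleGraph_five_three_subset_has_edge :
    ∀ s : Finset (Fin 5), s.card = 3 → ∃ u ∈ s, ∃ v ∈ s, (SimpleGraph.cycleGraph 5).Adj u v := by
  decide

/-- … and a non-edge between distinct vertices. -/
theorem cycleGraph_five_three_subset_has_nonedge :
    ∀ s : Finset (Fin 5), s.card = 3 → ∃ u ∈ s, ∃ v ∈ s, u ≠ v ∧ ¬ (SimpleGraph.cycleGraph 5).Adj u v := by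
  decide

/-- `α(C₅) ≤ 2`. [folklore] -/
theorem indepNum_cycleGraph_five_le_two : (SimpleGraph.cycleGraph 5).indepNum ≤ 2 := by
  obtain ⟨s, hs⟩ := (SimpleGraph.cycleGraph 5).exists_isNIndepSet_indepNum
  rw [← hs.card_eq]
  by_contra hlt
  push Not at hlt
  obtain ⟨u, hus, hucard⟩ := exists_subset_card_eq (show 3 ≤ s.card by omega)
  obtain ⟨a, ha, b, hb, hab⟩ := cycleGraph_five_three_subset_has_edge u hucard
  exact hs.isIndepSet (mem_coe.2 (hus ha)) (mem_coe.2 (hus hb)) hab.ne hab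

/-- `α(C₅ᶜ) ≤ 2`. [folklore] -/
theorem indepNum_compl_cycleGraph_five_le_two : (SimpleGraph.cycleGraph 5)ᶜ.indepNum ≤ 2 := by
  obtain ⟨s, hs⟩ := (SimpleGraph.cycleGraph 5)ᶜ.exists_isNIndepSet_indepNum
  rw [← hs.card_eq]
  by_contra hlt
  push Not at hlt
  obtain ⟨u, hus, hucard⟩ := exists_subset_card_eq (show 3 ≤ s.card by omega)
  obtain ⟨a, ha, b, hb, hab, hnadj⟩ := cycleGraph_five_three_subset_has_nonedge u hucard
  exact hs.isIndepSet (mem_coe.2 (hus ha)) (mem_coe.2 (hus hb)) hab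
    ((SimpleGraph.compl_adj _ _ _).2 ⟨hab, hnadj⟩)

/-- **Level `2` on the pentagon**: `las₂(C₅) · las₂(C₅ᶜ) ≤ 4` (finite convergence: `las₂ = α ≤ 2`
on both sides), whereas `n = 5` (and the level-1 product is `ϑ(C₅)² = 5`). [credit: Disproof (c)] -/
theorem level_two_uncertaintyProduct_cycleGraph_five_le :
    lasserreStableBound (SimpleGraph.cycleGraph 5) 2 *
      lasserreStableBound (SimpleGraph.cycleGraph 5)ᶜ 2 ≤ 4 := by
  have h1 : lasserreStableBound (SimpleGraph.cycleGraph 5) 2 ≤ 2 := by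
    rw [lasserreStableBound_eq_indepNum Laurent2003_lasserre_exact_of_indepNum_le_holds _
      (by norm_num) indepNum_cycleGraph_five_le_two]
    exact_mod_cast indepNum_cycleGraph_five_le_two
  have h2 : lasserreStableBound (SimpleGraph.cycleGraph 5)ᶜ 2 ≤ 2 := by
    rw [lasserreStableBound_eq_indepNum Laurent2003_lasserre_exact_of_indepNum_le_holds _
      (by norm_num) indepNum_compl_cycleGraph_five_le_two]
    exact_mod_cast indepNum_compl_cycleGraph_five_le_two
  have h0 : 0 ≤ lasserreStableBound (SimpleGraph.cycleGraph 5)ᶜ 2 :=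
    lasserreStableBound_nonneg _ _ (by norm_num)
  calc lasserreStableBound (SimpleGraph.cycleGraph 5) 2 *
      lasserreStableBound (SimpleGraph.cycleGraph 5)ᶜ 2 ≤ 2 * 2 := mul_le_mul h1 h2 h0 (by norm_num)
    _ = 4 := by norm_num

end Pentagon

/-- **The Lovász shape does not persist to level `2`**: "`∀ t ≥ 1, ∀ n ≥ 1, ∀ G on Fin n,
n ≤ las_t(G) · las_t(Gᶜ)`" is false (witness `t = 2`, the pentagon). [credit: Disproof (c)] -/
theorem not_levelTwo_lovaszShape :
    ¬ ∀ t : ℕ, 1 ≤ t → ∀ n ≥ 1, ∀ G : SimpleGraph (Fin n),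
      (n : ℝ) ≤ lasserreStableBound G t * lasserreStableBound Gᶜ t := by
  intro h
  have h1 := h 2 (by norm_num) 5 (by norm_num) (SimpleGraph.cycleGraph 5)
  have h2 := level_two_uncertaintyProduct_cycleGraph_five_le
  have h5 : ((5 : ℕ) : ℝ) = 5 := by norm_num
  rw [h5] at h1
  linarith

/-! ### (d) The refutation surface at level `t`: graphs with `α ≤ t` -/

section Reduction

variable {V : Type} [Fintype V] [DecidableEq V]

/-- **`α(G) ≤ t ⇒ las_t(G) · las_t(Gᶜ) ≤ α(G) · ϑ(Gᶜ)`** (`t ≥ 1`): the first factor is exact by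
finite convergence (Laurent 2003, tree), the second is at most the level-1 value `ϑ`.
[credit: Disproof (d)] -/
theorem uncertaintyProduct_le_indepNum_mul_lovaszTheta (G : SimpleGraph V) {t : ℕ} (ht : 1 ≤ t)
    (hα : G.indepNum ≤ t) :
    lasserreStableBound G t * lasserreStableBound Gᶜ t ≤ G.indepNum * lovaszTheta Gᶜ := by
  rw [lasserreStableBound_eq_indepNum Laurent2003_lasserre_exact_of_indepNum_le_holds G ht hα]
  exact mul_le_mul_of_nonneg_left (lasserreStableBound_le_lovaszTheta Gᶜ ht) (Nat.cast_nonneg _)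

end Reduction

/-- **Exponent cap from a bounded-`α` family.** If for some `C` there are, beyond every `n₀`, graphs
`G` on `Fin n` with `α(G) ≤ t` and `ϑ(Gᶜ) ≤ C · n^γ`, then every `δ` admissible in `UP_t` at level
`t` satisfies `δ ≤ γ`. (Alon's explicit triangle-free Cayley graphs, `ϑ(complement) = Θ(n^{2/3})`
with `α(complement) = 2`, would give `δ₂ ≤ 2/3`; they are not in the tree. By Erdős–Szekeres every
such family has `γ ≥ 1/t`, so this surface never refutes the item.) [credit: Disproof (d)] -/
theorem delta_le_of_boundedAlpha_family {t : ℕ} (ht : 1 ≤ t) {γ C : ℝ}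
    (hfam : ∀ n₀ : ℕ, ∃ n ≥ n₀, ∃ G : SimpleGraph (Fin n), G.indepNum ≤ t ∧ lovaszTheta Gᶜ ≤ C * (n : ℝ) ^ γ)
    {δ : ℝ} {n₀ : ℕ}
    (h : ∀ n ≥ n₀, ∀ G : SimpleGraph (Fin n),
      (n : ℝ) ^ δ ≤ lasserreStableBound G t * lasserreStableBound Gᶜ t) : δ ≤ γ := by
  by_contra hlt
  push Not at hlt
  -- eventually `t * C * n ^ γ < n ^ δ`
  have hev : ∀ᶠ n : ℕ in Filter.atTop, (t : ℝ) * C < (n : ℝ) ^ (δ - γ) :=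
    ((tendsto_rpow_atTop (by linarith : 0 < δ - γ)).comp tendsto_natCast_atTop_atTop).eventually_gt_atTop _
  obtain ⟨N, hN⟩ := (hev.and (Filter.eventually_ge_atTop (max n₀ 1))).exists_forall_of_atTop
  obtain ⟨n, hnN, G, hαG, hθ⟩ := hfam N
  obtain ⟨hlt', hn1⟩ := hN n hnN
  have hn₀ : n₀ ≤ n := (le_max_left _ _).trans hn1
  have hnpos : (0 : ℝ) < n := by
    have : 1 ≤ n := (le_max_right _ _).trans hn1
    exact_mod_cast this
  have hmain := (h n hn₀ G).trans (uncertaintyProduct_le_indepNum_mul_lovaszTheta G ht hαG)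
  have hθnn : 0 ≤ lovaszTheta Gᶜ := lovaszTheta_nonneg _
  have hup : (G.indepNum : ℝ) * lovaszTheta Gᶜ ≤ t * (C * (n : ℝ) ^ γ) :=
    mul_le_mul (by exact_mod_cast hαG) hθ hθnn (Nat.cast_nonneg _)
  have hsplit : (n : ℝ) ^ δ = (n : ℝ) ^ (δ - γ) * (n : ℝ) ^ γ := by
    rw [← Real.rpow_add hnpos]; ring_nf
  have hγpos : 0 < (n : ℝ) ^ γ := Real.rpow_pos_of_pos hnpos γ
  have h6 : (n : ℝ) ^ (δ - γ) * (n : ℝ) ^ γ ≤ t * C * (n : ℝ) ^ γ := by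
    rw [← hsplit]; linarith
  have h7 : t * C * (n : ℝ) ^ γ < (n : ℝ) ^ (δ - γ) * (n : ℝ) ^ γ := by nlinarith
  linarith

end Summit.PneNP.PneNP.Theorems.SosUncertainty
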